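import Summits.AnomalousDissipation.AnomalousDissipation.Theorems.QuarticTightness.Negative.Anatomy
import Summits.AnomalousDissipation.AnomalousDissipation.Theorems.MomentParityMomentClosure
import Summits.AnomalousDissipation.AnomalousDissipation.Theorems.MomentParityQuarticTightnessStubWindowLimit
import Summits.AnomalousDissipation.AnomalousDissipation.Theorems.MomentParityQuarticTightnessStubMeanZeroFlow
import Summits.AnomalousDissipation.AnomalousDissipation.Theorems.MomentParityQuarticTightnessStubOrbitLift
import Summits.AnomalousDissipation.AnomalousDissipation.Theorems.MomentParityQuarticTightnessStubRowIdentity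
import Summits.AnomalousDissipation.AnomalousDissipation.Theorems.MomentParityQuarticTightnessStubAbsorbingBall
import Literature.Analysis.FluidPDE.GalerkinFlow

/-!
# Route MomentParity · crux `QuarticTightness` (stmt-AnomalousDissipation-14331), line `horizon-shooting`:
# moving-base Krylov–Bogoliubov for the level-`N` Galerkin system (two-budget window form)

Support file (`--supports stmt-AnomalousDissipation-14331`) of the line lead
(prover-line-stmt-AnomalousDissipation-14331-0; skeleton `Cruxes/QuarticTightness/Lines/Ideate3Sketch.lean`). It composes the
five landed stubs of the line —
`stub_windowLimit` (abstract weak-* limit of window empirical measures in a compact set),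
`stub_meanZeroFlow` (the Galerkin semiflow preserves zero mean), `stub_orbitLift` (the orbit as a continuous
`H`-valued level-`N` curve), `stub_rowIdentity` (the row of a polynomial cylindrical observable along the flow is an
exact time derivative) and `stub_absorbingBall` (the `L²` ball of radius `‖f‖₂/(4π²ν)` is forward invariant) —
into the packaging theorem of the line:

* `stub_horizonKrylovBogoliubov` — **HORIZON LOUDNESS ⇒ A LOUD BOUNDED GALERKIN-INVARIANT LAW.** If at
  `(f, ν, N)` every horizon `T > 0` admits ONE mean-zero Galerkin datum of order `N` in the absorbing ball whose
  window has injected work `≥ ε'T` and energy `≤ E'T` (the base point may move with `T`), then some Borel probability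
  law on `H = L²_σ(T³)` is level-`N` carried, supported in `‖u‖ ≤ ‖f‖₂/(4π²ν)`, all-order polynomially stationary for
  Galerkin NS at `(ν, f)`, with mean energy `≤ E'` and dissipation `≥ ε'`
  (`QuarticTightness.Negative.IsInvariantWitness`). Windows `T n = n + 1`; the window empirical measures live on the
  compact level ball (`MomentParityMomentClosure.isCompact_levelBall`); rows of the limit vanish because along a window
  they are boundary terms `(p(u_T) − p(u_0))/T` with `|p| ≤ M` on the ball; energy passes to the limit; dissipation
  `= ∫(u,f)dμ` by the energy row (`ensembleDissipation_eq_of_polyStationary`) and `∫(u,f)dμ ≥ ε'` passes to the limit.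
* `invariantFamily_of_horizonLoud`, `ladderConcl_of_horizonLoud` — the same along a viscosity sequence: horizon
  loudness with `j`-uniform budgets, `N`-frequently at every `j`, gives the Galerkin-invariant loud family
  (`InvariantFamily`, the body of `GalerkinInvariantLoud` at that force) and hence the loud ladder at every order
  (`LadderConcl`, the conclusion of `QuarticTightness`; Anatomy's `ladderConcl_of_invariantFamily`).

What is NOT here: the universal finite-horizon loudness itself (stub `stub_universalHorizonLoud` of the skeleton —
the Galerkin-ensemble zeroth law for every nonzero force in sup-over-data form; open), and any theorem concluding the
crux by name (that composition stays in the skeleton until the last stub lands). Sources: Krylov–Bogoliubov /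
time-average measures (FMRT 2001, Ch. IV §2–3 and App. B); Tobasco–Goluskin–Doering 2018 §5 (sup over trajectories =
max over invariant measures; the tree's `Literature.Dynamics.Ergodic.TobascoGoluskinDoering2018_measureForm_holds` is
the one-observable Euclidean form — here two budgets, moving base point, phase space `P_N H ⊂ H`).
-/

noncomputable section

-- `Summit.<Summit>.<Problem>` is the tree's mandated summit-side namespace (CONVENTIONS §2); for this
-- single-conjunct summit the two coincide, so the duplicate is deliberate.
set_option linter.dupNamespace false

namespace Summit.AnomalousDissipation.AnomalousDissipation.Theorems.MomentParityQuarticTightness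

open MeasureTheory Filter Topology Set
open scoped ENNReal InnerProductSpace RealInnerProductSpace
open Literature.Analysis.FunctionSpaces Literature.Analysis.FluidPDE
open Summit.AnomalousDissipation.AnomalousDissipation.Theses.MomentParity
open Summit.AnomalousDissipation.AnomalousDissipation.Theorems
open Summit.AnomalousDissipation.AnomalousDissipation.Theorems.QuarticGate.Negative
open Summit.AnomalousDissipation.AnomalousDissipation.Theorems.QuarticTightness.Negative

-- `T3 = T³`, `R3 = ℝ³`, `H3 = H`, `L2T3 = L²(T³; ℝ³)` (sibling crux's abbreviations).
open Summit.AnomalousDissipation.AnomalousDissipation.Theorems.CubicParityLoud.Negative (T3 R3 H3 L2T3)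

/-- **MOVING-BASE KRYLOV–BOGOLIUBOV FOR THE LEVEL-`N` GALERKIN SYSTEM (two-budget window form).** If at
`(f, ν, N)` (`f` smooth mean-zero, `ν > 0`) every horizon `T > 0` has a mean-zero Galerkin datum of order `N` in the
absorbing ball `‖a‖₂ ≤ ‖f‖₂/(4π²ν)` with window work `∫₀ᵀ (f, u_t) dt ≥ ε'T` and window energy `∫₀ᵀ ‖u_t‖₂² dt ≤ E'T`
(`u_t = galerkinFlow ν f N t a`; the datum may depend on `T`), then some Borel probability law on `H` is level-`N`
carried, supported in `‖u‖ ≤ ‖f‖₂/(4π²ν)`, all-order polynomially stationary for Galerkin NS at `(ν, f)`, with mean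
energy `≤ E'` and dissipation `≥ ε'` — an `IsInvariantWitness f ν N (‖f‖₂/(4π²ν)) E' ε'`. Proof: windows `T n = n+1`;
S2/S3 lift the orbits to continuous `H`-valued curves in the compact level ball (S5, `isCompact_levelBall`); S1 gives
the limit law; rows vanish by S4 (boundary term `(p(u_T) − p(u_0))/T`, `|p| ≤ M` on the ball); energy passes to the
limit; dissipation `= ∫(u,f)dμ` (energy row, `ensembleDissipation_eq_of_polyStationary`) `≥ ε'` passes to the limit.
[folklore] -/
theorem stub_horizonKrylovBogoliubov {f : T3 → R3} (hfs : Torus.IsSmooth f)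
    (hfz : Torus.HasZeroMean f) {ν : ℝ} (hν : 0 < ν) {N : ℕ} {E' ε' : ℝ}
    (hH : ∀ T : ℝ, 0 < T → ∃ a : T3 → R3, IsGalerkinMode N a ∧ Torus.HasZeroMean a ∧
      ∫ x, ‖a x‖ ^ 2 ≤ (Real.sqrt (∫ x, ‖f x‖ ^ 2) / (4 * Real.pi ^ 2 * ν)) ^ 2 ∧
      ε' * T ≤ ∫ t in (0 : ℝ)..T, ∫ x, ⟪f x, Torus.galerkinFlow ν f N t a x⟫_ℝ ∧
      ∫ t in (0 : ℝ)..T, ∫ x, ‖Torus.galerkinFlow ν f N t a x‖ ^ 2 ≤ E' * T) :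
    ∃ μ : Measure H3,
      IsInvariantWitness f ν N (Real.sqrt (∫ x, ‖f x‖ ^ 2) / (4 * Real.pi ^ 2 * ν)) E' ε' μ := by
  set R : ℝ := Real.sqrt (∫ x, ‖f x‖ ^ 2) / (4 * Real.pi ^ 2 * ν) with hRdef
  have hR0 : 0 ≤ R := by positivity
  have hf2 : MemLp f 2 volume := hfs.memLp 2
  have hfi : Integrable f volume := hf2.integrable one_le_two
  -- horizons `T n = n + 1` and the shooting data
  set T : ℕ → ℝ := fun n => (n : ℝ) + 1 with hTdef
  have hT : ∀ n, 0 < T n := fun n => by positivity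
  choose a ha ha0 haR hinj hen using fun n => hH (T n) (hT n)
  -- zero mean along the orbits (S2) and the `H`-valued lifts (S3)
  have hmean : ∀ n t, 0 ≤ t → Torus.HasZeroMean (Torus.galerkinFlow ν f N t (a n)) :=
    fun n t ht => stub_meanZeroFlow ν f N (a n) hν.le hfs hfz (ha n) (ha0 n) t ht
  choose U hUc hU using fun n => stub_orbitLift ν f N (a n) hν.le hfs (ha n) (hmean n)
  -- the compact carrier
  set K : Set H3 := {u : H3 | IsLevel N u ∧ ‖u‖ ≤ R} with hKdef
  have hK : IsCompact K := MomentParityMomentClosure.isCompact_levelBall N hR0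
  -- norms and pairings along the lifted orbits
  have hnorm : ∀ n t, 0 ≤ t → ‖U n t‖ ^ 2 = ∫ x, ‖Torus.galerkinFlow ν f N t (a n) x‖ ^ 2 := by
    intro n t ht
    have h1 : ‖U n t‖ = ‖((U n t).1 : L2T3)‖ := rfl
    rw [h1, ← Torus.integral_norm_sq_coe_eq]
    exact integral_congr_ae ((hU n t ht).2.mono fun x hx => by simp only [hx])
  have hpair : ∀ n t, 0 ≤ t →
      Torus.pairing (U n t).1 f = ∫ x, ⟪f x, Torus.galerkinFlow ν f N t (a n) x⟫_ℝ := by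
    intro n t ht
    unfold Torus.pairing
    exact integral_congr_ae ((hU n t ht).2.mono fun x hx => by
      show ⟪((U n t).1 : T3 → R3) x, f x⟫_ℝ = ⟪f x, Torus.galerkinFlow ν f N t (a n) x⟫_ℝ
      rw [hx, real_inner_comm])
  have hUK : ∀ n, ∀ t ∈ Icc 0 (T n), U n t ∈ K := by
    intro n t ht
    refine ⟨(hU n t ht.1).1, ?_⟩
    have h := stub_absorbingBall ν f N (a n) hν hfs (ha n) (hmean n) le_rfl (haR n) t ht.1
    rw [← hnorm n t ht.1] at h
    exact (pow_le_pow_iff_left₀ (norm_nonneg _) hR0 two_ne_zero).1 h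
  have hUc' : ∀ n, ContinuousOn (U n) (Icc 0 (T n)) := fun n => (hUc n).mono Icc_subset_Ici_self
  -- the limit law (S1)
  obtain ⟨μ, hμP, hμK, hlim⟩ := stub_windowLimit hK U T hT hUc' hUK
  haveI := hμP
  have hlev : ∀ᵐ u ∂μ, IsLevel N u := hμK.mono fun u hu => hu.1
  have hball : ∀ᵐ u ∂μ, ‖u‖ ≤ R := hμK.mono fun u hu => hu.2
  have h2 : Integrable (fun u : H3 => ‖u‖ ^ 2) μ := integrable_norm_pow_of_ae_le hball 2
  -- all-order stationarity: rows are boundary terms (S4)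
  have hrows : ∀ (m : ℕ) (g : Fin m → T3 → R3) (P : MvPolynomial (Fin m) ℝ),
      (∀ i, IsBandTest N (g i)) →
      Integrable (fun u => Torus.nsGeneratorPairing ν f u (polyGrad g P u)) μ ∧
        ∫ u, Torus.nsGeneratorPairing ν f u (polyGrad g P u) ∂μ = 0 := by
    intro m g P hg
    have hgs : ∀ i, Torus.IsSmooth (g i) := fun i => (hg i).1
    have hFc : Continuous fun u : H3 => Torus.nsGeneratorPairing ν f u (polyGrad g P u) :=
      MomentParityMomentClosure.continuous_nsGeneratorPairing_polyGrad ν hfi hgs P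
    refine ⟨MomentParityMomentClosure.integrable_of_continuous_of_ae_mem hK hμK hFc, ?_⟩
    -- the observable `p` and its bound on `K`
    have hpc : Continuous fun u : H3 => MvPolynomial.eval (fun j => Torus.pairing u.1 (g j)) P :=
      MomentParityMomentClosure.continuous_eval_pderiv hgs P
    obtain ⟨M, hM⟩ := hK.exists_bound_of_continuousOn hpc.continuousOn
    have hsmall : ∀ δ : ℝ, 0 < δ →
        ∫ u, Torus.nsGeneratorPairing ν f u (polyGrad g P u) ∂μ ∈ Icc (-δ) δ := by
      intro δ hδ
      refine hlim _ hFc _ isClosed_Icc ?_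
      obtain ⟨n₀, hn₀⟩ := exists_nat_ge (2 * max M 0 / δ)
      refine eventually_atTop.2 ⟨n₀, fun n hn => ?_⟩
      have hTn : 2 * max M 0 / δ ≤ T n := by
        refine hn₀.trans ?_
        have : (n₀ : ℝ) ≤ n := by exact_mod_cast hn
        show (n₀ : ℝ) ≤ (n : ℝ) + 1
        linarith
      rw [stub_rowIdentity ν f N (a n) hν.le hfs (ha n) (U n) (hUc n) (fun t ht => (hU n t ht).2)
        g hg P (T n) (hT n).le]
      have hb1 : ‖MvPolynomial.eval (fun i => Torus.pairing (U n (T n)).1 (g i)) P‖ ≤ max M 0 :=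
        (hM _ (hUK n _ ⟨(hT n).le, le_rfl⟩)).trans (le_max_left _ _)
      have hb0 : ‖MvPolynomial.eval (fun i => Torus.pairing (U n 0).1 (g i)) P‖ ≤ max M 0 :=
        (hM _ (hUK n 0 ⟨le_rfl, (hT n).le⟩)).trans (le_max_left _ _)
      rw [Real.norm_eq_abs] at hb1 hb0
      rw [mem_Icc, ← abs_le, abs_mul, abs_inv, abs_of_pos (hT n)]
      have hdiff : |MvPolynomial.eval (fun i => Torus.pairing (U n (T n)).1 (g i)) P -
          MvPolynomial.eval (fun i => Torus.pairing (U n 0).1 (g i)) P| ≤ 2 * max M 0 :=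
        (abs_sub _ _).trans (by linarith)
      calc (T n)⁻¹ * |MvPolynomial.eval (fun i => Torus.pairing (U n (T n)).1 (g i)) P -
            MvPolynomial.eval (fun i => Torus.pairing (U n 0).1 (g i)) P|
          ≤ (T n)⁻¹ * (2 * max M 0) := by gcongr
        _ ≤ δ := by
            rw [inv_mul_le_iff₀ (hT n)]
            rw [div_le_iff₀ hδ] at hTn
            linarith
    have h0 : |∫ u, Torus.nsGeneratorPairing ν f u (polyGrad g P u) ∂μ| ≤ 0 :=
      le_of_forall_pos_le_add fun δ hδ => by
        rw [zero_add]
        exact abs_le.2 ⟨(hsmall δ hδ).1, (hsmall δ hδ).2⟩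
    exact abs_nonpos_iff.1 h0
  refine ⟨μ, hμP, hlev, hball, hrows, ?_, ?_⟩
  · -- mean energy `≤ E'`
    refine hlim (fun u : H3 => ‖u‖ ^ 2) (continuous_norm.pow 2) (Iic E') isClosed_Iic
      (Eventually.of_forall fun n => ?_)
    show (T n)⁻¹ * ∫ t in (0 : ℝ)..T n, ‖U n t‖ ^ 2 ≤ E'
    have hcongr : ∫ t in (0 : ℝ)..T n, ‖U n t‖ ^ 2 =
        ∫ t in (0 : ℝ)..T n, ∫ x, ‖Torus.galerkinFlow ν f N t (a n) x‖ ^ 2 := by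
      refine intervalIntegral.integral_congr fun t ht => ?_
      rw [uIcc_of_le (hT n).le] at ht
      exact hnorm n t ht.1
    rw [hcongr, inv_mul_le_iff₀ (hT n), mul_comm]
    exact hen n
  · -- dissipation `≥ ε'` through the energy row
    rw [ensembleDissipation_eq_of_polyStationary f hf2 hlev h2 le_rfl
      (fun m g P hg _ => hrows m g P hg)]
    refine hlim (fun u : H3 => Torus.pairing u.1 f) (Torus.continuous_pairing_coe hf2) (Ici ε')
      isClosed_Ici (Eventually.of_forall fun n => ?_)
    show ε' ≤ (T n)⁻¹ * ∫ t in (0 : ℝ)..T n, Torus.pairing (U n t).1 f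
    have hcongr : ∫ t in (0 : ℝ)..T n, Torus.pairing (U n t).1 f =
        ∫ t in (0 : ℝ)..T n, ∫ x, ⟪f x, Torus.galerkinFlow ν f N t (a n) x⟫_ℝ := by
      refine intervalIntegral.integral_congr fun t ht => ?_
      rw [uIcc_of_le (hT n).le] at ht
      exact hpair n t ht.1
    rw [hcongr, le_inv_mul_iff₀ (hT n), mul_comm]
    exact hinj n

/-- **Horizon loudness along a viscosity sequence gives the Galerkin-invariant loud family.** If a smooth
mean-zero force `f` has, at every `j`, for infinitely many levels `N`, horizon loudness at `(f, ν j, N)` with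
`j`-UNIFORM budgets `(E', ε')` from the absorbing ball, then `InvariantFamily f ν E' ε'` (the body of
`GalerkinInvariantLoud` at `f`, support radii `‖f‖₂/(4π²ν_j)`). [folklore] -/
theorem invariantFamily_of_horizonLoud {f : T3 → R3} (hfs : Torus.IsSmooth f) (hfz : Torus.HasZeroMean f)
    {ν : ℕ → ℝ} (hν : ∀ j, 0 < ν j) {E' ε' : ℝ}
    (hH : ∀ j : ℕ, ∃ᶠ N in atTop, ∀ T : ℝ, 0 < T → ∃ a : T3 → R3, IsGalerkinMode N a ∧ Torus.HasZeroMean a ∧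
      ∫ x, ‖a x‖ ^ 2 ≤ (Real.sqrt (∫ x, ‖f x‖ ^ 2) / (4 * Real.pi ^ 2 * ν j)) ^ 2 ∧
      ε' * T ≤ ∫ t in (0 : ℝ)..T, ∫ x, ⟪f x, Torus.galerkinFlow (ν j) f N t a x⟫_ℝ ∧
      ∫ t in (0 : ℝ)..T, ∫ x, ‖Torus.galerkinFlow (ν j) f N t a x‖ ^ 2 ≤ E' * T) :
    InvariantFamily f ν E' ε' := fun j =>
  ⟨_, (hH j).mono fun _ hN => stub_horizonKrylovBogoliubov hfs hfz (hν j) hN⟩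

/-- **Horizon loudness along a viscosity sequence gives the loud ladder at every order** (the conclusion of
`QuarticTightness` at the force `f` with budgets `(E', ε')`): `InvariantFamily ⇒ LadderConcl` is Anatomy's
`ladderConcl_of_invariantFamily`. [folklore] -/
theorem ladderConcl_of_horizonLoud {f : T3 → R3} (hfs : Torus.IsSmooth f) (hfz : Torus.HasZeroMean f)
    {ν : ℕ → ℝ} (hν : ∀ j, 0 < ν j) {E' ε' : ℝ}
    (hH : ∀ j : ℕ, ∃ᶠ N in atTop, ∀ T : ℝ, 0 < T → ∃ a : T3 → R3, IsGalerkinMode N a ∧ Torus.HasZeroMean a ∧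
      ∫ x, ‖a x‖ ^ 2 ≤ (Real.sqrt (∫ x, ‖f x‖ ^ 2) / (4 * Real.pi ^ 2 * ν j)) ^ 2 ∧
      ε' * T ≤ ∫ t in (0 : ℝ)..T, ∫ x, ⟪f x, Torus.galerkinFlow (ν j) f N t a x⟫_ℝ ∧
      ∫ t in (0 : ℝ)..T, ∫ x, ‖Torus.galerkinFlow (ν j) f N t a x‖ ^ 2 ≤ E' * T) :
    LadderConcl f ν E' ε' :=
  ladderConcl_of_invariantFamily (invariantFamily_of_horizonLoud hfs hfz hν hH)

end Summit.AnomalousDissipation.AnomalousDissipation.Theorems.MomentParityQuarticTightness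

end
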